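import Mathlib
import Summits.NavierStokesRegularity.NavierStokesRegularity.Theorems.EulerZoomLiouvillePowerGaugeEulerLiouvilleNeedleCauchyLocal
import Summits.NavierStokesRegularity.NavierStokesRegularity.Theorems.EulerZoomLiouvillePowerGaugeEulerLiouvilleNeedleLiouvilleLocal
import Summits.NavierStokesRegularity.NavierStokesRegularity.Theorems.EulerZoomLiouvillePowerGaugeEulerLiouvilleNeedleResidenceHyperbolic

/-!
# THE COMPRESSION CRITERION along lingering backward cut-off orbits (plate t40f of ROUND-40, nsreg-p2 g33's spec)

Width piece for crux `EulerZoomLiouville.PowerGaugeEulerLiouville` (stmt-NavierStokesRegularity-19832), by name under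
LEAD 19832 (ns-typeII-p2 g12); seat ns-ezl-w2 g3, `--supports stmt-NavierStokesRegularity-19832 --as helper`.
Setting of t40a/t40b/t40c: `(U, P)` a self-similar Euler profile with clock `γ`, `V ∈ C²` a cut-off copy (`‖DV‖ ≤ K`,
`V = U` on `ball 0 R_big`), `M < R_big`, `Ψ_σ := Φ^V_{−σ}` the backward flow of the similarity transport field
`W = γ x + V(x)`, `J_σ := DΨ_σ(y)`; the label `y` LINGERS: `‖Ψ_σ y‖ ≤ M` for `σ ∈ [0, L]`.  NEW INPUT: a continuous
COMPRESSION MAJORANT `κ : ℝ³ → ℝ` with `⟪DU(z) v, v⟫ ≥ −κ(z)‖v‖²` on `B̄_M`.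

* (C1) `norm_fderiv_flow_le_exp_integral_linger` — VARIABLE-RATE GRÖNWALL (upper): for `σ ∈ [0, L]`,
  `‖J_σ‖ ≤ exp(∫₀^σ (κ(Ψ_s y) − γ) ds)`  [`φ(σ) := ‖J_σ v‖²` has `φ' = −2γφ − 2⟪DV(Ψ_σ y)J_σ v, J_σ v⟫ ≤ 2(κ(Ψ_σ y) − γ)φ`
  by the backward variational equation (t40b `hasDerivAt_fderiv_flow_neg_apply`) and `DV = DU` on the ball; so
  `e^{−2g}φ` is antitone, `g(σ) := ∫₀^σ (κ(Ψ_s y) − γ)`].  No profile hypothesis is needed here.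
* (C2) `half_add_log_le_integral_compression` — **THE CRITERION**: if moreover `‖curl U‖ ≤ O` on `B̄_M` and `curl U y ≠ 0`,
  then for `σ ∈ [0, L]`:  `σ/2 + log(‖curl U y‖/O)/2 ≤ ∫₀^σ κ(Ψ_s y) ds`
  [t40c `norm_fderiv_flow_sq_ge_linger`: `‖curl U y‖ e^{(1−2γ)σ} ≤ O‖J_σ‖²`, and (C1)²; take logarithms; `(1−2γ)σ + 2γσ = σ`].
  NO hypothesis on `γ` is used: along EVERY lingering vortical orbit the time-averaged compression is
  `≥ 1/2 − log(O/‖curl U y‖)/(2σ)` — a `ρ`-FREE universal rate, sharp (`= 1/2`) at transversally symmetric vortical nodes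
  (t40e `exists_inner_fderiv_le_neg_half_of_stagnation`).
* (C3) `volume_highCompression_ge` — TIME IN THE HIGH-COMPRESSION SET: if `κ ≤ S` on `B̄_M` and `q < S`, then
  `vol{s ∈ [0, σ] : κ(Ψ_s y) ≥ q} ≥ (σ(1/2 − q) + log(‖curl U y‖/O)/2)/(S − q)`
  [split `∫₀^σ κ(Ψ_s y) ≤ q·vol{κ < q} + S·vol{κ ≥ q}`].
* (C4) `volume_opNorm_fderiv_ge_linger` — the SHARP-RATE instance `κ := ‖DU‖` (Cauchy–Schwarz): the orbit spends time
  `≥ (σ(1/2 − q) + log(‖curl U y‖/O)/2)/(S − q)` in `{s : ‖DU(Ψ_s y)‖ ≥ q}`, `S ≥ sup_{B̄_M}‖DU‖` — the orbit-side companion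
  of ns-in-ser-c g3's (K3) volume bound `vol({q ≤ ‖DU‖} ∩ B_L) ≲ L^{1−ρ}/q²` (…NeedleWaitingRoomThin).

MEANING (nsreg-p2 g33, ROUND-40 §2 (K2′)+(K3)): every lingering vortical orbit spends a time-FRACTION
`≥ (1/2 − q)/(S − q) − o(1)` inside the thin set `{‖DU‖ ≥ q}`; with (K3) this is the typed input of the R40 residence law.

HONEST FRAMING: statements about the flow of HYPOTHETICAL self-similar Euler profiles (blow-up needles); nothing here proves
the crux E `PowerGaugeEulerLiouville` (19832 OPEN), any door Target, or any Navier–Stokes regularity statement; MODEL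
lattice only (19832 is a crux CLASS — E/NS strata — not NS regularity); no summit statement is touched.
[cite: ConstantinIgnatovaVicol2026Putative, §3.4.1 eq. (3.22)–(3.24); folklore (Grönwall, Chebyshev)]
-/

noncomputable section

open Set Filter Topology Metric Function MeasureTheory
open scoped RealInnerProductSpace NNReal ENNReal

set_option linter.dupNamespace false

namespace Summit.NavierStokesRegularity.NavierStokesRegularity.Theorems.PowerGaugeEulerLiouville.NeedleClock

open Literature.Analysis Literature.Analysis.FluidPDE
open Summit.NavierStokesRegularity.NavierStokesRegularity.Theorems.PowerGaugeEulerLiouville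

variable {γ : ℝ} {U V : EuclideanSpace ℝ (Fin 3) → EuclideanSpace ℝ (Fin 3)} {P : EuclideanSpace ℝ (Fin 3) → ℝ}

/-! ## (C1) Variable-rate Grönwall bound for the backward Jacobian -/

/-- **VARIABLE-RATE GRÖNWALL (upper bound) along a lingering backward orbit.**  `V ∈ C²`, `‖DV‖ ≤ K`, `V = U` on
`ball 0 R_big`, `M < R_big`, `κ` a continuous compression majorant of `DU` on `B̄_M` (`⟪DU(z)v, v⟫ ≥ −κ(z)‖v‖²`); if
`‖Ψ_σ y‖ ≤ M` for `σ ∈ [0, L]` then `‖DΨ_σ(y)‖ ≤ exp(∫₀^σ (κ(Ψ_s y) − γ) ds)` for `σ ∈ [0, L]`.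
[cite: ConstantinIgnatovaVicol2026Putative, §3.4.1 eq. (3.22); folklore (Grönwall)] -/
theorem norm_fderiv_flow_le_exp_integral_linger (hV : ContDiff ℝ 2 V) {K : ℝ}
    (hK : ∀ y, ‖fderiv ℝ V y‖ ≤ K) {M Rbig : ℝ} (hMR : M < Rbig)
    (hVU : ∀ w ∈ ball (0 : EuclideanSpace ℝ (Fin 3)) Rbig, V w = U w)
    {κ : EuclideanSpace ℝ (Fin 3) → ℝ} (hκc : Continuous κ)
    (hκ : ∀ z ∈ closedBall (0 : EuclideanSpace ℝ (Fin 3)) M, ∀ v : EuclideanSpace ℝ (Fin 3),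
      -(κ z * ‖v‖ ^ 2) ≤ ⟪fderiv ℝ U z v, v⟫)
    {y : EuclideanSpace ℝ (Fin 3)} {L : ℝ}
    (hy : ∀ σ ∈ Icc (0 : ℝ) L, ‖ODE.evolutionMap (fun _ : ℝ => selfSimilarTransport γ 0 V) 0 (-σ) y‖ ≤ M) :
    ∀ σ ∈ Icc (0 : ℝ) L,
      ‖fderiv ℝ (ODE.evolutionMap (fun _ : ℝ => selfSimilarTransport γ 0 V) 0 (-σ)) y‖ ≤
        Real.exp (∫ s in (0 : ℝ)..σ,
          (κ (ODE.evolutionMap (fun _ : ℝ => selfSimilarTransport γ 0 V) 0 (-s) y) - γ)) := by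
  intro σ hσ
  have hL : 0 ≤ L := hσ.1.trans hσ.2
  have hV1 : ContDiff ℝ 1 V := hV.of_le (by norm_num)
  have hzball : ∀ s ∈ Icc (0 : ℝ) L, ODE.evolutionMap (fun _ : ℝ => selfSimilarTransport γ 0 V) 0 (-s) y ∈
      ball (0 : EuclideanSpace ℝ (Fin 3)) Rbig :=
    fun s hs => mem_ball_zero_iff.2 (lt_of_le_of_lt (hy s hs) hMR)
  have hzcl : ∀ s ∈ Icc (0 : ℝ) L, ODE.evolutionMap (fun _ : ℝ => selfSimilarTransport γ 0 V) 0 (-s) y ∈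
      closedBall (0 : EuclideanSpace ℝ (Fin 3)) M :=
    fun s hs => mem_closedBall_zero_iff.2 (hy s hs)
  -- orbit continuity and the rate function `g`
  have hflow : Continuous fun t : ℝ => ODE.evolutionMap (fun _ : ℝ => selfSimilarTransport γ 0 V) 0 (-t) y :=
    continuous_iff_continuousAt.2 fun t => (C2.Kelvin.hasDerivAt_flow_neg (γ := γ) hV1 hK y t).continuousAt
  have hrate : Continuous fun s : ℝ =>
      κ (ODE.evolutionMap (fun _ : ℝ => selfSimilarTransport γ 0 V) 0 (-s) y) - γ :=
    (hκc.comp hflow).sub continuous_const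
  set g : ℝ → ℝ := fun r => ∫ s in (0 : ℝ)..r,
    (κ (ODE.evolutionMap (fun _ : ℝ => selfSimilarTransport γ 0 V) 0 (-s) y) - γ) with hg
  have hg' : ∀ r, HasDerivAt g
      (κ (ODE.evolutionMap (fun _ : ℝ => selfSimilarTransport γ 0 V) 0 (-r) y) - γ) r :=
    fun r => (hrate.integral_hasStrictDerivAt 0 r).hasDerivAt
  have hg0 : g 0 = 0 := by simp [hg]
  -- the operator curve
  set J : ℝ → (EuclideanSpace ℝ (Fin 3) →L[ℝ] EuclideanSpace ℝ (Fin 3)) := fun r =>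
    fderiv ℝ (ODE.evolutionMap (fun _ : ℝ => selfSimilarTransport γ 0 V) 0 (-r)) y with hJ
  have hJ0 : J 0 = ContinuousLinearMap.id ℝ (EuclideanSpace ℝ (Fin 3)) := by
    have hΦ0 : ODE.evolutionMap (fun _ : ℝ => selfSimilarTransport γ 0 V) 0 0 = id :=
      funext (ODE.evolutionMap_self _ 0)
    simp only [hJ, neg_zero, hΦ0, fderiv_id]
  refine ContinuousLinearMap.opNorm_le_bound _ (Real.exp_pos _).le fun v => ?_
  -- `φ(r) = ‖J r v‖²` and `ψ := e^{−2g} φ`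
  have hJ' : ∀ r, HasDerivAt (fun u => J u v)
      (-(γ • J r v + fderiv ℝ V (ODE.evolutionMap (fun _ : ℝ => selfSimilarTransport γ 0 V) 0 (-r) y) (J r v))) r :=
    fun r => hasDerivAt_fderiv_flow_neg_apply (γ := γ) hV hK y v r
  have hφ' : ∀ r, HasDerivAt (fun u => ‖J u v‖ ^ 2)
      (2 * ⟪J r v, -(γ • J r v +
        fderiv ℝ V (ODE.evolutionMap (fun _ : ℝ => selfSimilarTransport γ 0 V) 0 (-r) y) (J r v))⟫) r :=
    fun r => (hJ' r).norm_sq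
  set ψ : ℝ → ℝ := fun r => Real.exp (-(2 * g r)) * ‖J r v‖ ^ 2 with hψ
  have hψ' : ∀ r, HasDerivAt ψ
      (Real.exp (-(2 * g r)) *
          (-(2 * (κ (ODE.evolutionMap (fun _ : ℝ => selfSimilarTransport γ 0 V) 0 (-r) y) - γ))) * ‖J r v‖ ^ 2 +
        Real.exp (-(2 * g r)) * (2 * ⟪J r v, -(γ • J r v +
          fderiv ℝ V (ODE.evolutionMap (fun _ : ℝ => selfSimilarTransport γ 0 V) 0 (-r) y) (J r v))⟫)) r := by
    intro r
    have h1 : HasDerivAt (fun u => Real.exp (-(2 * g u)))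
        (Real.exp (-(2 * g r)) *
          (-(2 * (κ (ODE.evolutionMap (fun _ : ℝ => selfSimilarTransport γ 0 V) 0 (-r) y) - γ)))) r :=
      (((hg' r).const_mul 2).neg).exp
    exact h1.mul (hφ' r)
  -- sign of `ψ'` on `[0, L]`
  have hsign : ∀ r ∈ Icc (0 : ℝ) L,
      Real.exp (-(2 * g r)) *
          (-(2 * (κ (ODE.evolutionMap (fun _ : ℝ => selfSimilarTransport γ 0 V) 0 (-r) y) - γ))) * ‖J r v‖ ^ 2 +
        Real.exp (-(2 * g r)) * (2 * ⟪J r v, -(γ • J r v +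
          fderiv ℝ V (ODE.evolutionMap (fun _ : ℝ => selfSimilarTransport γ 0 V) 0 (-r) y) (J r v))⟫) ≤ 0 := by
    intro r hr
    set z := ODE.evolutionMap (fun _ : ℝ => selfSimilarTransport γ 0 V) 0 (-r) y with hz
    set w := J r v with hw
    have hDV : fderiv ℝ V z = fderiv ℝ U z := fderiv_eq_of_agree_ball hVU (hzball r hr)
    have hinner : ⟪w, -(γ • w + fderiv ℝ V z w)⟫ = -(γ * ‖w‖ ^ 2) - ⟪fderiv ℝ U z w, w⟫ := by
      rw [hDV, inner_neg_right, inner_add_right, real_inner_smul_right, real_inner_self_eq_norm_sq,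
        real_inner_comm (fderiv ℝ U z w) w]
      ring
    have hk := hκ z (hzcl r hr) w
    have hE : 0 < Real.exp (-(2 * g r)) := Real.exp_pos _
    rw [hinner]
    have e : Real.exp (-(2 * g r)) * (-(2 * (κ z - γ))) * ‖w‖ ^ 2 +
        Real.exp (-(2 * g r)) * (2 * (-(γ * ‖w‖ ^ 2) - ⟪fderiv ℝ U z w, w⟫)) =
        -(2 * (Real.exp (-(2 * g r)) * (κ z * ‖w‖ ^ 2 + ⟪fderiv ℝ U z w, w⟫))) := by ring
    rw [e]
    have h2 : 0 ≤ κ z * ‖w‖ ^ 2 + ⟪fderiv ℝ U z w, w⟫ := by linarith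
    have h3 := mul_nonneg hE.le h2
    linarith
  -- `ψ` is antitone on `[0, L]`
  have hanti : AntitoneOn ψ (Icc 0 L) := by
    refine antitoneOn_of_hasDerivWithinAt_nonpos (convex_Icc 0 L)
      (fun r _ => (hψ' r).continuousAt.continuousWithinAt) (fun r _ => (hψ' r).hasDerivWithinAt) ?_
    intro r hr
    rw [interior_Icc] at hr
    exact hsign r (Ioo_subset_Icc_self hr)
  have hψσ : ψ σ ≤ ψ 0 := hanti (left_mem_Icc.2 hL) hσ hσ.1
  have hψ0 : ψ 0 = ‖v‖ ^ 2 := by simp [hψ, hg0, hJ0]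
  rw [hψ0] at hψσ
  have hmain : ‖J σ v‖ ^ 2 ≤ (Real.exp (g σ) * ‖v‖) ^ 2 := by
    have h2 : Real.exp (2 * g σ) * ψ σ = ‖J σ v‖ ^ 2 := by
      simp only [hψ]
      rw [← mul_assoc, ← Real.exp_add, add_neg_cancel, Real.exp_zero, one_mul]
    calc ‖J σ v‖ ^ 2 = Real.exp (2 * g σ) * ψ σ := h2.symm
      _ ≤ Real.exp (2 * g σ) * ‖v‖ ^ 2 := mul_le_mul_of_nonneg_left hψσ (Real.exp_pos _).le
      _ = (Real.exp (g σ) * ‖v‖) ^ 2 := by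
          rw [mul_pow, ← Real.exp_nat_mul]
          norm_num
  exact le_of_pow_le_pow_left₀ two_ne_zero (by positivity) hmain

/-! ## (C2) The compression criterion -/

/-- **THE COMPRESSION CRITERION.**  `(U, P)` a self-similar Euler profile, `V ∈ C²` a cut-off copy (`‖DV‖ ≤ K`, `V = U` on
`ball 0 R_big`), `M < R_big`, `κ` a continuous compression majorant of `DU` on `B̄_M`, `‖curl U‖ ≤ O` on `B̄_M`,
`curl U y ≠ 0`; if the backward orbit of `y` lingers in `B̄_M` during `[0, L]`, then for every `σ ∈ [0, L]`:
`σ/2 + log(‖curl U y‖/O)/2 ≤ ∫₀^σ κ(Ψ_s y) ds`.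
No hypothesis on the clock `γ` is needed (`(1 − 2γ)σ + 2γσ = σ`): along every lingering vortical orbit the time-averaged
compression is at least `1/2 − log(O/‖curl U y‖)/(2σ)`.
[cite: ConstantinIgnatovaVicol2026Putative, §3.4.1 eq. (3.22)–(3.24); folklore] -/
theorem half_add_log_le_integral_compression (hprof : IsSelfSimilarEulerProfile γ 0 U P) (hV : ContDiff ℝ 2 V)
    {K : ℝ} (hK : ∀ y, ‖fderiv ℝ V y‖ ≤ K) {M Rbig : ℝ} (hMR : M < Rbig)
    (hVU : ∀ w ∈ ball (0 : EuclideanSpace ℝ (Fin 3)) Rbig, V w = U w)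
    {κ : EuclideanSpace ℝ (Fin 3) → ℝ} (hκc : Continuous κ)
    (hκ : ∀ z ∈ closedBall (0 : EuclideanSpace ℝ (Fin 3)) M, ∀ v : EuclideanSpace ℝ (Fin 3),
      -(κ z * ‖v‖ ^ 2) ≤ ⟪fderiv ℝ U z v, v⟫)
    {O : ℝ} (hO : ∀ z ∈ closedBall (0 : EuclideanSpace ℝ (Fin 3)) M, ‖curl U z‖ ≤ O)
    {y : EuclideanSpace ℝ (Fin 3)} (hΩ : curl U y ≠ 0) {L : ℝ}
    (hy : ∀ σ ∈ Icc (0 : ℝ) L, ‖ODE.evolutionMap (fun _ : ℝ => selfSimilarTransport γ 0 V) 0 (-σ) y‖ ≤ M) :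
    ∀ σ ∈ Icc (0 : ℝ) L,
      σ / 2 + Real.log (‖curl U y‖ / O) / 2 ≤
        ∫ s in (0 : ℝ)..σ, κ (ODE.evolutionMap (fun _ : ℝ => selfSimilarTransport γ 0 V) 0 (-s) y) := by
  intro σ hσ
  have hL : 0 ≤ L := hσ.1.trans hσ.2
  have hV1 : ContDiff ℝ 1 V := hV.of_le (by norm_num)
  have hω : 0 < ‖curl U y‖ := norm_pos_iff.2 hΩ
  have hy0 : y ∈ closedBall (0 : EuclideanSpace ℝ (Fin 3)) M := by
    have h := hy 0 (left_mem_Icc.2 hL)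
    rw [neg_zero, ODE.evolutionMap_self] at h
    exact mem_closedBall_zero_iff.2 h
  have hOpos : 0 < O := hω.trans_le (hO y hy0)
  have h1 := norm_fderiv_flow_sq_ge_linger hprof hV hK hMR hVU hO hy σ hσ
  have h2 := norm_fderiv_flow_le_exp_integral_linger hV hK hMR hVU hκc hκ hy σ hσ
  -- continuity of the rate along the orbit
  have hflow : Continuous fun t : ℝ => ODE.evolutionMap (fun _ : ℝ => selfSimilarTransport γ 0 V) 0 (-t) y :=
    continuous_iff_continuousAt.2 fun t => (C2.Kelvin.hasDerivAt_flow_neg (γ := γ) hV1 hK y t).continuousAt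
  have hcont : Continuous fun s : ℝ => κ (ODE.evolutionMap (fun _ : ℝ => selfSimilarTransport γ 0 V) 0 (-s) y) :=
    hκc.comp hflow
  set G : ℝ := ∫ s in (0 : ℝ)..σ,
    (κ (ODE.evolutionMap (fun _ : ℝ => selfSimilarTransport γ 0 V) 0 (-s) y) - γ) with hG
  have hGsplit : G = (∫ s in (0 : ℝ)..σ,
      κ (ODE.evolutionMap (fun _ : ℝ => selfSimilarTransport γ 0 V) 0 (-s) y)) - γ * σ := by
    rw [hG, intervalIntegral.integral_sub (hcont.intervalIntegrable 0 σ) intervalIntegrable_const,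
      intervalIntegral.integral_const, smul_eq_mul]
    ring
  have h3 : ‖curl U y‖ * Real.exp ((1 - 2 * γ) * σ) ≤ O * Real.exp (2 * G) := by
    calc ‖curl U y‖ * Real.exp ((1 - 2 * γ) * σ)
        ≤ O * ‖fderiv ℝ (ODE.evolutionMap (fun _ : ℝ => selfSimilarTransport γ 0 V) 0 (-σ)) y‖ ^ 2 := h1
      _ ≤ O * (Real.exp G) ^ 2 :=
          mul_le_mul_of_nonneg_left (pow_le_pow_left₀ (norm_nonneg _) h2 2) hOpos.le
      _ = O * Real.exp (2 * G) := by
          rw [← Real.exp_nat_mul]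
          norm_num
  have h4 : Real.log (‖curl U y‖ * Real.exp ((1 - 2 * γ) * σ)) ≤ Real.log (O * Real.exp (2 * G)) :=
    Real.log_le_log (mul_pos hω (Real.exp_pos _)) h3
  rw [Real.log_mul hω.ne' (Real.exp_pos _).ne', Real.log_exp, Real.log_mul hOpos.ne' (Real.exp_pos _).ne',
    Real.log_exp, hGsplit] at h4
  rw [Real.log_div hω.ne' hOpos.ne']
  linarith

/-! ## (C3) Time spent in the high-compression set -/

/-- **TIME IN THE HIGH-COMPRESSION SET.**  Under the hypotheses of the compression criterion, if `κ ≤ S` on `B̄_M` and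
`q < S`, then for every `σ ∈ [0, L]` the backward orbit of the vortical label `y` spends time
`≥ (σ(1/2 − q) + log(‖curl U y‖/O)/2)/(S − q)` in `{s ∈ [0, σ] : q ≤ κ(Ψ_s y)}`
(split `∫₀^σ κ(Ψ_s y) ds ≤ q·vol{κ < q} + S·vol{κ ≥ q}`). [folklore (Chebyshev); cite: ConstantinIgnatovaVicol2026Putative, §3.4.1] -/
theorem volume_highCompression_ge (hprof : IsSelfSimilarEulerProfile γ 0 U P) (hV : ContDiff ℝ 2 V)
    {K : ℝ} (hK : ∀ y, ‖fderiv ℝ V y‖ ≤ K) {M Rbig : ℝ} (hMR : M < Rbig)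
    (hVU : ∀ w ∈ ball (0 : EuclideanSpace ℝ (Fin 3)) Rbig, V w = U w)
    {κ : EuclideanSpace ℝ (Fin 3) → ℝ} (hκc : Continuous κ)
    (hκ : ∀ z ∈ closedBall (0 : EuclideanSpace ℝ (Fin 3)) M, ∀ v : EuclideanSpace ℝ (Fin 3),
      -(κ z * ‖v‖ ^ 2) ≤ ⟪fderiv ℝ U z v, v⟫)
    {O : ℝ} (hO : ∀ z ∈ closedBall (0 : EuclideanSpace ℝ (Fin 3)) M, ‖curl U z‖ ≤ O)
    {y : EuclideanSpace ℝ (Fin 3)} (hΩ : curl U y ≠ 0) {L : ℝ}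
    (hy : ∀ σ ∈ Icc (0 : ℝ) L, ‖ODE.evolutionMap (fun _ : ℝ => selfSimilarTransport γ 0 V) 0 (-σ) y‖ ≤ M)
    {S q : ℝ} (hqS : q < S) (hκS : ∀ z ∈ closedBall (0 : EuclideanSpace ℝ (Fin 3)) M, κ z ≤ S)
    {σ : ℝ} (hσ : σ ∈ Icc (0 : ℝ) L) :
    ENNReal.ofReal ((σ * (1 / 2 - q) + Real.log (‖curl U y‖ / O) / 2) / (S - q)) ≤
      volume {s ∈ Icc (0 : ℝ) σ |
        q ≤ κ (ODE.evolutionMap (fun _ : ℝ => selfSimilarTransport γ 0 V) 0 (-s) y)} := by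
  have hσ0 : 0 ≤ σ := hσ.1
  have hV1 : ContDiff ℝ 1 V := hV.of_le (by norm_num)
  have hC2 := half_add_log_le_integral_compression hprof hV hK hMR hVU hκc hκ hO hΩ hy σ hσ
  -- the rate along the orbit, as a continuous function of backward time
  have hflow : Continuous fun t : ℝ => ODE.evolutionMap (fun _ : ℝ => selfSimilarTransport γ 0 V) 0 (-t) y :=
    continuous_iff_continuousAt.2 fun t => (C2.Kelvin.hasDerivAt_flow_neg (γ := γ) hV1 hK y t).continuousAt
  set f : ℝ → ℝ := fun s => κ (ODE.evolutionMap (fun _ : ℝ => selfSimilarTransport γ 0 V) 0 (-s) y) with hf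
  have hfc : Continuous f := hκc.comp hflow
  set t : Set ℝ := {s | q ≤ f s} with ht
  have htm : MeasurableSet t := (isClosed_le continuous_const hfc).measurableSet
  set A : Set ℝ := {s ∈ Icc (0 : ℝ) σ |
    q ≤ κ (ODE.evolutionMap (fun _ : ℝ => selfSimilarTransport γ 0 V) 0 (-s) y)} with hA
  have hAsub : Ioc (0 : ℝ) σ ∩ t ⊆ A := fun s hs => ⟨Ioc_subset_Icc_self hs.1, hs.2⟩
  have hAfin : volume A ≠ ⊤ :=
    ((measure_mono (fun s (hs : s ∈ A) => hs.1)).trans_lt measure_Icc_lt_top).ne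
  -- the integral of the criterion as a set integral over `Ioc 0 σ`, split along `t`
  have hI : ∫ s in (0 : ℝ)..σ, κ (ODE.evolutionMap (fun _ : ℝ => selfSimilarTransport γ 0 V) 0 (-s) y) =
      ∫ s in Ioc (0 : ℝ) σ, f s := intervalIntegral.integral_of_le hσ0
  have hfi : IntegrableOn f (Ioc (0 : ℝ) σ) :=
    (hfc.continuousOn.integrableOn_compact isCompact_Icc).mono_set Ioc_subset_Icc_self
  have hsplit := integral_inter_add_sdiff htm hfi
  have hzcl : ∀ s ∈ Ioc (0 : ℝ) σ, ODE.evolutionMap (fun _ : ℝ => selfSimilarTransport γ 0 V) 0 (-s) y ∈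
      closedBall (0 : EuclideanSpace ℝ (Fin 3)) M :=
    fun s hs => mem_closedBall_zero_iff.2 (hy s ⟨hs.1.le, hs.2.trans hσ.2⟩)
  have hfin1 : volume (Ioc (0 : ℝ) σ ∩ t) ≠ ⊤ := (measure_mono inter_subset_left).trans_lt measure_Ioc_lt_top |>.ne
  have hfin2 : volume (Ioc (0 : ℝ) σ \ t) ≠ ⊤ := (measure_mono sdiff_subset).trans_lt measure_Ioc_lt_top |>.ne
  have hb1 : ∫ s in Ioc (0 : ℝ) σ ∩ t, f s ≤ (volume (Ioc (0 : ℝ) σ ∩ t)).toReal * S := by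
    have h := setIntegral_mono_on (hfi.mono_set inter_subset_left) (integrableOn_const hfin1)
      (measurableSet_Ioc.inter htm) (fun s hs => hκS _ (hzcl s hs.1))
    rwa [setIntegral_const, smul_eq_mul, measureReal_def] at h
  have hb2 : ∫ s in Ioc (0 : ℝ) σ \ t, f s ≤ (volume (Ioc (0 : ℝ) σ \ t)).toReal * q := by
    have h := setIntegral_mono_on (hfi.mono_set sdiff_subset) (integrableOn_const hfin2)
      (measurableSet_Ioc.diff htm) (fun s hs => (not_le.1 hs.2).le)
    rwa [setIntegral_const, smul_eq_mul, measureReal_def] at h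
  have hab : (volume (Ioc (0 : ℝ) σ ∩ t)).toReal + (volume (Ioc (0 : ℝ) σ \ t)).toReal = σ := by
    have h := measure_inter_add_sdiff (μ := volume) (Ioc (0 : ℝ) σ) htm
    rw [Real.volume_Ioc, sub_zero] at h
    have h' := congrArg ENNReal.toReal h
    rwa [ENNReal.toReal_add hfin1 hfin2, ENNReal.toReal_ofReal hσ0] at h'
  have hI2 : ∫ s in (0 : ℝ)..σ, κ (ODE.evolutionMap (fun _ : ℝ => selfSimilarTransport γ 0 V) 0 (-s) y) ≤
      q * σ + (S - q) * (volume (Ioc (0 : ℝ) σ ∩ t)).toReal := by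
    have hab' : (volume (Ioc (0 : ℝ) σ \ t)).toReal * q =
        σ * q - (volume (Ioc (0 : ℝ) σ ∩ t)).toReal * q := by
      linear_combination q * hab
    rw [hI, ← hsplit]
    linarith [hb1, hb2, hab']
  have ha_le : (volume (Ioc (0 : ℝ) σ ∩ t)).toReal ≤ (volume A).toReal :=
    ENNReal.toReal_mono hAfin (measure_mono hAsub)
  have hSq : 0 < S - q := sub_pos.2 hqS
  have h5 : (S - q) * (volume (Ioc (0 : ℝ) σ ∩ t)).toReal ≤ (S - q) * (volume A).toReal :=
    mul_le_mul_of_nonneg_left ha_le hSq.le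
  have hkey : (σ * (1 / 2 - q) + Real.log (‖curl U y‖ / O) / 2) / (S - q) ≤ (volume A).toReal := by
    rw [div_le_iff₀ hSq]
    nlinarith [hC2, hI2, h5]
  exact ENNReal.ofReal_le_of_le_toReal hkey

/-! ## (C4) The sharp-rate instance `κ = ‖DU‖` -/

/-- **TIME NEAR LARGE GRADIENTS (sharp-rate instance `κ := ‖DU‖`).**  `(U, P)` a self-similar Euler profile, `V ∈ C²` a
cut-off copy, `M < R_big`, `‖curl U‖ ≤ O` and `‖DU‖ ≤ S` on `B̄_M`, `q < S`, `curl U y ≠ 0`; if the backward orbit of `y`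
lingers in `B̄_M` during `[0, L]` then for every `σ ∈ [0, L]` it spends time
`≥ (σ(1/2 − q) + log(‖curl U y‖/O)/2)/(S − q)` in `{s ∈ [0, σ] : q ≤ ‖DU(Ψ_s y)‖}`
(`⟪DU(z)v, v⟫ ≥ −‖DU(z)‖‖v‖²` by Cauchy–Schwarz).  Orbit-side companion of the (K3) volume bound
`vol({q ≤ ‖DU‖} ∩ B_L) ≲ L^{1−ρ}/q²`. [folklore; cite: ConstantinIgnatovaVicol2026Putative, §3.4.1] -/
theorem volume_opNorm_fderiv_ge_linger (hprof : IsSelfSimilarEulerProfile γ 0 U P) (hV : ContDiff ℝ 2 V)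
    {K : ℝ} (hK : ∀ y, ‖fderiv ℝ V y‖ ≤ K) {M Rbig : ℝ} (hMR : M < Rbig)
    (hVU : ∀ w ∈ ball (0 : EuclideanSpace ℝ (Fin 3)) Rbig, V w = U w)
    {O : ℝ} (hO : ∀ z ∈ closedBall (0 : EuclideanSpace ℝ (Fin 3)) M, ‖curl U z‖ ≤ O)
    {S : ℝ} (hS : ∀ z ∈ closedBall (0 : EuclideanSpace ℝ (Fin 3)) M, ‖fderiv ℝ U z‖ ≤ S) {q : ℝ} (hqS : q < S)
    {y : EuclideanSpace ℝ (Fin 3)} (hΩ : curl U y ≠ 0) {L : ℝ}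
    (hy : ∀ σ ∈ Icc (0 : ℝ) L, ‖ODE.evolutionMap (fun _ : ℝ => selfSimilarTransport γ 0 V) 0 (-σ) y‖ ≤ M)
    {σ : ℝ} (hσ : σ ∈ Icc (0 : ℝ) L) :
    ENNReal.ofReal ((σ * (1 / 2 - q) + Real.log (‖curl U y‖ / O) / 2) / (S - q)) ≤
      volume {s ∈ Icc (0 : ℝ) σ |
        q ≤ ‖fderiv ℝ U (ODE.evolutionMap (fun _ : ℝ => selfSimilarTransport γ 0 V) 0 (-s) y)‖} := by
  have hU2 : ContDiff ℝ 2 U := hprof.isSelfSimilarEulerVorticityProfile.contDiff_velocity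
  have hκc : Continuous fun z : EuclideanSpace ℝ (Fin 3) => ‖fderiv ℝ U z‖ :=
    (hU2.continuous_fderiv (by norm_num)).norm
  have hκ : ∀ z ∈ closedBall (0 : EuclideanSpace ℝ (Fin 3)) M, ∀ v : EuclideanSpace ℝ (Fin 3),
      -(‖fderiv ℝ U z‖ * ‖v‖ ^ 2) ≤ ⟪fderiv ℝ U z v, v⟫ := by
    intro z _ v
    have h1 := abs_real_inner_le_norm (fderiv ℝ U z v) v
    have h2 : ‖fderiv ℝ U z v‖ ≤ ‖fderiv ℝ U z‖ * ‖v‖ := ContinuousLinearMap.le_opNorm _ _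
    have h3 : ‖fderiv ℝ U z v‖ * ‖v‖ ≤ ‖fderiv ℝ U z‖ * ‖v‖ * ‖v‖ :=
      mul_le_mul_of_nonneg_right h2 (norm_nonneg _)
    have h4 := (abs_le.1 h1).1
    nlinarith [h4, h3]
  exact volume_highCompression_ge hprof hV hK hMR hVU hκc hκ hO hΩ hy hqS hS hσ

end Summit.NavierStokesRegularity.NavierStokesRegularity.Theorems.PowerGaugeEulerLiouville.NeedleClock

end
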